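import Summits.AtomisticToContinuum.Crystallization.Theorems.HolmgrenBoyleLindGroundStatesChargeFLCEquilibriumOfMinimisingLawsChargeFLC
import Summits.AtomisticToContinuum.Crystallization.Theses.IsometryAtoms
import Literature.Probability.Process.LocallyMatches

/-!
# Crux `HolmgrenBoyleLind.GroundStatesChargeFLCEquilibrium` (stmt-AtomisticToContinuum-6076),
# line `registered`: the local support of a law of configurations, and the FLC entry point

The content stub `stub_minimisingLawsChargeFLC` of the line asks that every minimising
point-stationary hard-core law `P` charge, at every scale `(R, ε)`, the patches of ONE FLC Delone
set `Λ` at one base point — i.e. that some FLC Delone configuration lie in the LOCAL SUPPORT of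
`P` (every two-way `(R, ε)`-matching event of it has positive `P`-mass). This file proves the
measure-theoretic half of the route's own two-layer plan "LIM ⇐ NoFoam → PalmLimitFLC → LIM":

* `ae_measure_locallyMatches_ne_zero`, `ae_forall_measure_locallyMatches_ne_zero` — **almost every
  configuration lies in the local support of its law**: for ANY measure `P` on `Measure E` (`E` a
  proper normed group), `P`-a.e. `ν` has `P {ν' | LocallyMatches R ε (atoms ν) (atoms ν')} ≠ 0`
  for all `R` and all `ε > 0`. Proof (no topology on `Measure E`, no measurability of the events):
  fix a finite `ε/2`-net `t` of the closed `R`-ball; the "cell" of a configuration is the set of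
  net points `ε/2`-close to its atoms of norm `≤ R`; two configurations with the same cell are
  `(R, ε)`-matched, so a configuration whose matching event is null lies in a null cell, and there
  are finitely many cells. (The separable-metric "a.e. point is in the support" argument, run on
  the basic entourages of the local rubber topology of Baake–Lenz.)
* `chargedFLC_of_frequently_flcDelone` — hence, for a law `P` a.s. carried by rooted `δ`-hard-core
  configurations: if with POSITIVE (outer) probability the configuration is relatively dense and of
  finite local complexity, then the conclusion of `stub_minimisingLawsChargeFLC` holds for `P`
  (`Λ :=` the atoms of one such configuration in the local support, `q₀ := 0`, `A := id`).
* `stub_minimisingLawsChargeFLC_of_cohesive_of_frequentlyFLC` — the stub, at the law level, from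
  COHESION (`IsometryAtoms.MinimisingLawsCohesive`, item 15777: a.s. relative density) and the
  inlined hypothesis "under every minimising point-stationary hard-core law the configurations of
  finite local complexity are not null" (PalmLimitFLC in its weakest measurable form); and
  `groundStatesChargeFLCEquilibrium_of_cohesive_of_frequentlyFLC` — composed with the landed
  `groundStatesChargeFLCEquilibrium_of_minimisingLawsChargeFLC` (p146085), the crux itself.

This is the FLC-specific entry point of the crux: no atom / purity (15776), no Bieberbach-type
bridge (15778) and no periodicity is asked — only cohesion and non-null finite local complexity.
CONDITIONAL reduction plus an unconditional support lemma; nothing here closes an item.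
All `[folklore]` (support of a measure on a second-countable space; Baake–Lenz local topology).
-/

noncomputable section

open MeasureTheory Filter Set Metric
open scoped ENNReal Topology

namespace Summit.AtomisticToContinuum.Crystallization.Theorems.HolmgrenBoyleLindGroundStatesChargeFLCEquilibrium

open Literature.Probability.Process

/-! ### Almost every configuration lies in the local support of its law -/

section LocalSupport

variable {E : Type*} [NormedAddCommGroup E] [MeasurableSpace E]

/-- **Cells.** The CELL of tolerance `η` and radius `R` attached to a set `F` of net points is the
set of configurations `ν` such that every point of `F` has an atom of `ν` within `η` and every atom
of `ν` of norm `≤ R` has a point of `F` within `η` (the two clauses are kept as separate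
hypotheses; no definition is introduced). Two configurations in the same cell are two-way
`(R, η + η)`-matched. [folklore] -/
theorem locallyMatches_of_cell {R η : ℝ} {F : Set E} {ν₁ ν₂ : Measure E}
    (h₁F : ∀ d ∈ F, ∃ p, ν₁ {p} ≠ 0 ∧ dist p d ≤ η)
    (h₁R : ∀ p, ν₁ {p} ≠ 0 → ‖p‖ ≤ R → ∃ d ∈ F, dist p d ≤ η)
    (h₂F : ∀ d ∈ F, ∃ p, ν₂ {p} ≠ 0 ∧ dist p d ≤ η)
    (h₂R : ∀ p, ν₂ {p} ≠ 0 → ‖p‖ ≤ R → ∃ d ∈ F, dist p d ≤ η) :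
    LocallyMatches R (η + η) (atoms ν₁) (atoms ν₂) := by
  refine ⟨fun p hp hpR => ?_, fun q hq hqR => ?_⟩
  · obtain ⟨d, hd, hpd⟩ := h₂R p hp hpR
    obtain ⟨q, hq, hqd⟩ := h₁F d hd
    refine ⟨q, hq, ?_⟩
    calc dist q p ≤ dist q d + dist d p := dist_triangle _ _ _
      _ ≤ η + η := add_le_add hqd (by rwa [dist_comm])
  · obtain ⟨d, hd, hqd⟩ := h₁R q hq hqR
    obtain ⟨p, hp, hpd⟩ := h₂F d hd
    refine ⟨p, hp, ?_⟩
    calc dist q p ≤ dist q d + dist d p := dist_triangle _ _ _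
      _ ≤ η + η := add_le_add hqd (by rwa [dist_comm])

/-- **Every configuration lies in its own cell**: if `t` is an `η`-net of the closed `R`-ball,
every atom of `ν` of norm `≤ R` is `η`-close to a point of `t` that is `η`-close to an atom of
`ν` of norm `≤ R` (the first clause of the cell of `ν` holds by definition). [folklore] -/
theorem exists_netPoint_of_atom {R η : ℝ} {t : Set E}
    (ht : closedBall (0 : E) R ⊆ ⋃ d ∈ t, ball d η) (ν : Measure E) :
    ∀ p, ν {p} ≠ 0 → ‖p‖ ≤ R →
      ∃ d ∈ {d ∈ t | ∃ p, ν {p} ≠ 0 ∧ ‖p‖ ≤ R ∧ dist p d ≤ η}, dist p d ≤ η := by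
  intro p hp hpR
  have hmem : p ∈ ⋃ d ∈ t, ball d η := ht (mem_closedBall_zero_iff.2 hpR)
  simp only [mem_iUnion, mem_ball] at hmem
  obtain ⟨d, hdt, hpd⟩ := hmem
  exact ⟨d, ⟨hdt, p, hp, hpR, hpd.le⟩, hpd.le⟩

variable [ProperSpace E]

/-- **Almost every configuration lies in the local support of its law, one scale.** For any
measure `P` on configurations-as-measures of a proper normed group, any radius `R` and any
tolerance `ε > 0`, `P`-almost every `ν` has its two-way `(R, ε)`-matching event charged:
`P {ν' | LocallyMatches R ε (atoms ν) (atoms ν')} ≠ 0`. No measurability of the events is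
needed (outer measure). [folklore] -/
theorem ae_measure_locallyMatches_ne_zero (P : Measure (Measure E)) (R : ℝ) {ε : ℝ}
    (hε : 0 < ε) :
    ∀ᵐ ν ∂P, P {ν' | LocallyMatches R ε (atoms ν) (atoms ν')} ≠ 0 := by
  -- a finite `ε/2`-net of the closed `R`-ball
  have hη : 0 < ε / 2 := half_pos hε
  obtain ⟨t, -, htfin, ht⟩ :=
    finite_cover_balls_of_compact (isCompact_closedBall (0 : E) R) hη
  -- the net points of the cell of a configuration, and the cell of a set of net points
  set net : Measure E → Set E := fun ν => {d ∈ t | ∃ p, ν {p} ≠ 0 ∧ ‖p‖ ≤ R ∧ dist p d ≤ ε / 2}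
    with hnet
  set cell : Set E → Set (Measure E) := fun F =>
    {ν | (∀ d ∈ F, ∃ p, ν {p} ≠ 0 ∧ dist p d ≤ ε / 2) ∧
      (∀ p, ν {p} ≠ 0 → ‖p‖ ≤ R → ∃ d ∈ F, dist p d ≤ ε / 2)} with hcell
  have hnet_sub : ∀ ν, net ν ⊆ t := fun ν d hd => hd.1
  have hself : ∀ ν, ν ∈ cell (net ν) := fun ν =>
    ⟨fun d hd => hd.2.imp fun p hp => ⟨hp.1, hp.2.2⟩, exists_netPoint_of_atom ht ν⟩
  rw [ae_iff]
  -- the bad set is covered by the null cells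
  refine measure_mono_null (t := ⋃ F ∈ {F : Set E | F ⊆ t},
      {ν | ¬P {ν' | LocallyMatches R ε (atoms ν) (atoms ν')} ≠ 0} ∩ cell F) ?_ ?_
  · intro ν hν
    exact mem_biUnion (hnet_sub ν) ⟨hν, hself ν⟩
  · refine (measure_biUnion_null_iff htfin.finite_subsets.countable).2 fun F _ => ?_
    rcases Set.eq_empty_or_nonempty
        ({ν | ¬P {ν' | LocallyMatches R ε (atoms ν) (atoms ν')} ≠ 0} ∩ cell F) with h | ⟨ν₀, hν₀, hν₀F⟩
    · rw [h, measure_empty]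
    · have h0 : P {ν' | LocallyMatches R ε (atoms ν₀) (atoms ν')} = 0 := not_ne_iff.1 hν₀
      refine measure_mono_null (fun ν hν => ?_) h0
      have := locallyMatches_of_cell hν₀F.1 hν₀F.2 hν.2.1 hν.2.2
      rwa [add_halves] at this

/-- **Almost every configuration lies in the local support of its law.** For any measure `P` on
configurations-as-measures of a proper normed group, `P`-almost every `ν` has ALL its two-way
matching events charged: `P {ν' | LocallyMatches R ε (atoms ν) (atoms ν')} ≠ 0` for every `R` and
every `ε > 0` (countably many scales suffice by monotonicity of the matchings). [folklore] -/
theorem ae_forall_measure_locallyMatches_ne_zero (P : Measure (Measure E)) :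
    ∀ᵐ ν ∂P, ∀ R ε : ℝ, 0 < ε → P {ν' | LocallyMatches R ε (atoms ν) (atoms ν')} ≠ 0 := by
  have h : ∀ᵐ ν ∂P, ∀ n k : ℕ,
      P {ν' | LocallyMatches (n : ℝ) (1 / ((k : ℝ) + 1)) (atoms ν) (atoms ν')} ≠ 0 :=
    ae_all_iff.2 fun n => ae_all_iff.2 fun k =>
      ae_measure_locallyMatches_ne_zero P n (by positivity)
  filter_upwards [h] with ν hν R ε hε
  obtain ⟨n, hn⟩ := exists_nat_ge R
  obtain ⟨k, hk⟩ := exists_nat_one_div_lt hε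
  exact fun h0 => hν n k (measure_mono_null (fun ν' hν' => hν'.mono hn hk.le) h0)

end LocalSupport

/-! ### The FLC entry point of the stub and of the crux -/

open Literature.MathematicalPhysics.StatisticalMechanics

/-- **Stub 1's conclusion for one law, from non-null FLC Delone configurations.** Let `P` be a law
on configurations of `ℝ³` a.s. carried by rooted `δ`-hard-core counting measures (`δ > 0`). If with
positive outer probability the configuration is relatively dense AND of finite local complexity,
then ONE `δ`-separated, relatively dense FLC set `Λ ∋ 0` has all its two-way matching events at the
base point `0` charged by `P` (with the identity isometry): take `Λ :=` the atoms of such a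
configuration lying in the local support (`ae_forall_measure_locallyMatches_ne_zero`). [folklore] -/
theorem chargedFLC_of_frequently_flcDelone {δ : ℝ} (hδ : 0 < δ)
    {P : Measure (Measure (EuclideanSpace ℝ (Fin 3)))}
    (hcore : ∀ᵐ μ ∂P, (∃ S : Set (EuclideanSpace ℝ (Fin 3)), (0 : EuclideanSpace ℝ (Fin 3)) ∈ S ∧
      (∀ x ∈ S, ∀ y ∈ S, x ≠ y → δ ≤ dist x y) ∧
      μ = (Measure.count : Measure (EuclideanSpace ℝ (Fin 3))).restrict S))
    (hfreq : ∃ᵐ μ ∂P, (∃ r : ℝ, 0 < r ∧ ∀ c : EuclideanSpace ℝ (Fin 3),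
        ∃ y : EuclideanSpace ℝ (Fin 3), μ {y} ≠ 0 ∧ dist y c ≤ r) ∧
      ∀ R : ℝ, Set.Finite {T : Set (EuclideanSpace ℝ (Fin 3)) |
        ∃ x : EuclideanSpace ℝ (Fin 3), μ {x} ≠ 0 ∧
          T = {v : EuclideanSpace ℝ (Fin 3) | μ {x + v} ≠ 0 ∧ ‖v‖ ≤ R}}) :
    ∃ (Λ : Set (EuclideanSpace ℝ (Fin 3))) (δ' r : ℝ), 0 < δ' ∧ 0 < r ∧
      (∀ x ∈ Λ, ∀ y ∈ Λ, x ≠ y → δ' ≤ dist x y) ∧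
      (∀ c : EuclideanSpace ℝ (Fin 3), ∃ y ∈ Λ, dist y c ≤ r) ∧
      (∀ R : ℝ, Set.Finite {S : Set (EuclideanSpace ℝ (Fin 3)) |
        ∃ x ∈ Λ, S = {v : EuclideanSpace ℝ (Fin 3) | x + v ∈ Λ ∧ ‖v‖ ≤ R}}) ∧
      ∃ q₀ ∈ Λ, ∀ R ε : ℝ, 0 < R → 0 < ε →
        P {ν : Measure (EuclideanSpace ℝ (Fin 3)) |
            ∃ A : EuclideanSpace ℝ (Fin 3) →ₗᵢ[ℝ] EuclideanSpace ℝ (Fin 3),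
              (∀ s ∈ Λ, dist s q₀ ≤ R →
                ∃ p : EuclideanSpace ℝ (Fin 3), ν {p} ≠ 0 ∧ dist p (A (s - q₀)) ≤ ε) ∧
              (∀ p : EuclideanSpace ℝ (Fin 3), ν {p} ≠ 0 → ‖p‖ ≤ R →
                ∃ s ∈ Λ, dist p (A (s - q₀)) ≤ ε)} ≠ 0 := by
  -- one configuration that is hard-core, FLC Delone, and in the local support
  obtain ⟨ν₀, ⟨⟨r, hr, hden⟩, hflc⟩, hS, hsupp⟩ :=
    (hfreq.and_eventually (hcore.and (ae_forall_measure_locallyMatches_ne_zero P))).exists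
  obtain ⟨S₀, h0, hsep, rfl⟩ := hS
  simp only [count_restrict_singleton_ne_zero_iff] at hden hflc
  rw [atoms_count_restrict] at hsupp
  refine ⟨S₀, δ, r, hδ, hr, hsep, fun c => ?_, fun R => ?_, 0, h0, fun R ε _hR hε => ?_⟩
  · obtain ⟨y, hy, hyc⟩ := hden c
    exact ⟨y, hy, hyc⟩
  · convert hflc R using 3
  · refine fun h0P => hsupp R ε hε (measure_mono_null (fun ν hν => ?_) h0P)
    refine ⟨LinearIsometry.id, fun s hs hsR => ?_, fun p hp hpR => ?_⟩
    · rw [dist_zero_right] at hsR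
      obtain ⟨p, hp, hsp⟩ := hν.2 s hs hsR
      exact ⟨p, hp, by rwa [sub_zero, LinearIsometry.id_apply, dist_comm]⟩
    · obtain ⟨s, hs, hsp⟩ := hν.1 p hp hpR
      exact ⟨s, hs, by rwa [sub_zero, LinearIsometry.id_apply, dist_comm]⟩

/-- **The content stub from COHESION and NON-NULL FINITE LOCAL COMPLEXITY (law level).** If every
minimising point-stationary hard-core law on rooted configurations of `ℝ³` is a.s. relatively dense
(`IsometryAtoms.MinimisingLawsCohesive`, item 15777) and gives non-zero outer mass to the
configurations of finite local complexity (hypothesis inlined: the weakest measurable form of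
"PalmLimitFLC" in the route's two-layer plan), then `stub_minimisingLawsChargeFLC` holds verbatim.
The hypothesis frames agree definitionally (`IsRootedHardCore`, `IsPointStationaryLaw`,
`rootEnergy`). [folklore] -/
theorem stub_minimisingLawsChargeFLC_of_cohesive_of_frequentlyFLC
    (hCoh : Summit.AtomisticToContinuum.Crystallization.Theses.IsometryAtoms.MinimisingLawsCohesive)
    (hFLC : ∀ δ : ℝ, 0 < δ → ∀ P : Measure (Measure (EuclideanSpace ℝ (Fin 3))),
      IsProbabilityMeasure P → (∀ᵐ μ ∂P, IsRootedHardCore δ μ) → IsPointStationaryLaw P →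
      (∫ μ, rootEnergy lennardJones μ ∂P) ≤
        (⨅ Q : PeriodicConfiguration 3, Q.energyPerParticle lennardJones) →
      ∃ᵐ μ ∂P, ∀ R : ℝ, Set.Finite {T : Set (EuclideanSpace ℝ (Fin 3)) |
        ∃ x : EuclideanSpace ℝ (Fin 3), μ {x} ≠ 0 ∧
          T = {v : EuclideanSpace ℝ (Fin 3) | μ {x + v} ≠ 0 ∧ ‖v‖ ≤ R}}) :
    ∀ δ : ℝ, 0 < δ → ∀ P : Measure (Measure (EuclideanSpace ℝ (Fin 3))), IsProbabilityMeasure P →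
      (∀ᵐ μ ∂P, (∃ S : Set (EuclideanSpace ℝ (Fin 3)), (0 : EuclideanSpace ℝ (Fin 3)) ∈ S ∧
        (∀ x ∈ S, ∀ y ∈ S, x ≠ y → δ ≤ dist x y) ∧
        μ = (Measure.count : Measure (EuclideanSpace ℝ (Fin 3))).restrict S)) →
      (∀ g : Measure (EuclideanSpace ℝ (Fin 3)) → EuclideanSpace ℝ (Fin 3) → ENNReal,
        Measurable (Function.uncurry g) →
        ∫⁻ μ, ∫⁻ y, g μ y ∂μ ∂P = ∫⁻ μ, ∫⁻ y, g (Measure.map (fun z => z - y) μ) (-y) ∂μ ∂P) →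
      (∫ μ, (∫ y, lennardJones ‖y‖ ∂μ) / 2 ∂P) ≤
        (⨅ Q : PeriodicConfiguration 3, Q.energyPerParticle lennardJones) →
      ∃ (Λ : Set (EuclideanSpace ℝ (Fin 3))) (δ' r : ℝ), 0 < δ' ∧ 0 < r ∧
        (∀ x ∈ Λ, ∀ y ∈ Λ, x ≠ y → δ' ≤ dist x y) ∧
        (∀ c : EuclideanSpace ℝ (Fin 3), ∃ y ∈ Λ, dist y c ≤ r) ∧
        (∀ R : ℝ, Set.Finite {S : Set (EuclideanSpace ℝ (Fin 3)) |
          ∃ x ∈ Λ, S = {v : EuclideanSpace ℝ (Fin 3) | x + v ∈ Λ ∧ ‖v‖ ≤ R}}) ∧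
        ∃ q₀ ∈ Λ, ∀ R ε : ℝ, 0 < R → 0 < ε →
          P {ν : Measure (EuclideanSpace ℝ (Fin 3)) |
              ∃ A : EuclideanSpace ℝ (Fin 3) →ₗᵢ[ℝ] EuclideanSpace ℝ (Fin 3),
                (∀ s ∈ Λ, dist s q₀ ≤ R →
                  ∃ p : EuclideanSpace ℝ (Fin 3), ν {p} ≠ 0 ∧ dist p (A (s - q₀)) ≤ ε) ∧
                (∀ p : EuclideanSpace ℝ (Fin 3), ν {p} ≠ 0 → ‖p‖ ≤ R →
                  ∃ s ∈ Λ, dist p (A (s - q₀)) ≤ ε)} ≠ 0 := by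
  intro δ hδ P hP hcore hstat hE
  have hcoh : ∀ᵐ μ ∂P, ∃ R₀ : ℝ, ∀ z : EuclideanSpace ℝ (Fin 3),
      ∃ y : EuclideanSpace ℝ (Fin 3), μ {y} ≠ 0 ∧ dist z y ≤ R₀ :=
    hCoh δ hδ P hP hcore hstat hE
  have hflc := hFLC δ hδ P hP hcore hstat hE
  refine chargedFLC_of_frequently_flcDelone hδ hcore ?_
  refine (hflc.and_eventually hcoh).mono fun μ ⟨hμflc, R₀, hR₀⟩ => ⟨⟨max R₀ 1, ?_, fun c => ?_⟩, hμflc⟩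
  · exact lt_of_lt_of_le one_pos (le_max_right _ _)
  · obtain ⟨y, hy, hyc⟩ := hR₀ c
    exact ⟨y, hy, (dist_comm y c).trans_le (hyc.trans (le_max_left _ _))⟩

/-- **The crux from COHESION and NON-NULL FINITE LOCAL COMPLEXITY** — the FLC entry point of
`GroundStatesChargeFLCEquilibrium`: `IsometryAtoms.MinimisingLawsCohesive` (item 15777) and "under
every minimising point-stationary hard-core law the FLC configurations are not null" give the crux,
by `stub_minimisingLawsChargeFLC_of_cohesive_of_frequentlyFLC` and the landed composition
`groundStatesChargeFLCEquilibrium_of_minimisingLawsChargeFLC` (Benjamini–Schramm limit, density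
transfer, finite-`N` criticality). No purity, no bridge, no periodicity. CONDITIONAL. [folklore] -/
theorem groundStatesChargeFLCEquilibrium_of_cohesive_of_frequentlyFLC : Summit.AtomisticToContinuum.Crystallization.Theses.IsometryAtoms.MinimisingLawsCohesive → (∀ δ : ℝ, 0 < δ → ∀ P : MeasureTheory.Measure (MeasureTheory.Measure (EuclideanSpace ℝ (Fin 3))), MeasureTheory.IsProbabilityMeasure P → (∀ᵐ μ ∂P, Literature.Probability.Process.IsRootedHardCore δ μ) → Literature.Probability.Process.IsPointStationaryLaw P → (∫ μ, Literature.MathematicalPhysics.StatisticalMechanics.rootEnergy Literature.MathematicalPhysics.StatisticalMechanics.lennardJones μ ∂P) ≤ (⨅ Q : Literature.MathematicalPhysics.StatisticalMechanics.PeriodicConfiguration 3, Q.energyPerParticle Literature.MathematicalPhysics.StatisticalMechanics.lennardJones) → ∃ᵐ μ ∂P, ∀ R : ℝ, Set.Finite {T : Set (EuclideanSpace ℝ (Fin 3)) | ∃ x : EuclideanSpace ℝ (Fin 3), μ {x} ≠ 0 ∧ T = {v : EuclideanSpace ℝ (Fin 3) | μ {x + v} ≠ 0 ∧ ‖v‖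 ≤ R}}) → Summit.AtomisticToContinuum.Crystallization.Theses.HolmgrenBoyleLind.GroundStatesChargeFLCEquilibrium :=
  fun hCoh hFLC => groundStatesChargeFLCEquilibrium_of_minimisingLawsChargeFLC
    (stub_minimisingLawsChargeFLC_of_cohesive_of_frequentlyFLC hCoh hFLC)

end Summit.AtomisticToContinuum.Crystallization.Theorems.HolmgrenBoyleLindGroundStatesChargeFLCEquilibrium

end
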